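import Literature.Geometry.Riemannian.FourShrinkerCurvatureBoundedOf
import Literature.Geometry.Riemannian.ShrinkerLocalisedMaximumPrinciple
import Literature.Geometry.Lorentzian.CoordShrinkerRmNormSqDrift
import Literature.Geometry.Lorentzian.CoordShrinkerRmDrift
import HarnessLib

/-!
# Munteanu–Wang 2015, Prop. 1.3 and Thm. 1.4 (first half): `|Ric|` and `|Rm|` are bounded on a
# complete four-dimensional gradient shrinking Ricci soliton with bounded scalar curvature

**Theorem** (O. Munteanu, J. Wang, *Geometry of shrinking Ricci solitons*, Compositio Math. 151
(2015) 2273–2300, Prop. 1.3 and Thm. 1.4, p. 6): a complete four-dimensional gradient shrinking Ricci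
soliton `Ric + Hess f = ½ g` with bounded scalar curvature `S ≤ A` has bounded Ricci and Riemann
curvature. UNCONDITIONAL forms of the assembly of `FourShrinkerCurvatureBoundedOf.lean`, for a connected
`M` modelled on `ℝ⁴`, `g` complete (closed `g`-balls compact) with its Levi-Civita connection, `f` smooth,
`Ric + Hess f = ½ g`, `R + |∇f|² = f`, `R ≤ A`:

* `FourShrinker.normSq_ricci_bounded` — **Prop. 1.3: `∃ C, |Ric|²_g ≤ C` on `M`**;
* `FourShrinker.curvNormSq_bounded` — **Thm. 1.4 (first half): `∃ C, |Rm|²_g = g.curvNormSqWith g.leviCivita ≤ C`**.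

The inputs: Prop. 1.1 (`CoordShrinkerCurvatureGradientBound.lean`), (1.10)
(`CoordShrinkerRicciNormSqDrift.lean`), Lemma 1.2/Prop. 1.3 at a point (`CoordShrinkerRicciPinching.lean`),
MW (id) + Kato for `|Rm|²` (`CoordShrinkerRmNormSqDrift.lean`, read here in an orthonormal frame in the
registered `∃ C ∀ … ∃ N` shape, `rm_drift_input`), the pointwise drift for `v = √(|Rm|²+1) + |Ric|²`
(`CoordShrinkerRmDrift.lean`), properness of `f` (`ShrinkerPotentialProper.lean`), the localised maximum
principle (`ShrinkerLocalisedMaximumPrinciple.lean`), `R ≥ 0` (`shrinkerScalarCurvature_nonneg_holds`).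
Step 1 of the printed chain behind the named fact `shrinkerSplittingAtInfinity_four`
(`ShrinkerSplittingAtInfinity.lean`; crux `EntropyRung.NoncompactShrinkerGap`, SmoothPoincare4). The second
half of Thm. 1.4 (`|∇Rm|`) is `FourShrinkerCovariantCurvatureBoundedOf.lean`. Everything is proved; no
definition and no statement of `Prop` type is introduced.

## References

* O. Munteanu, J. Wang, *Geometry of shrinking Ricci solitons*, Compositio Math. 151 (2015)
  2273–2300 = arXiv:1410.3813, §1: Prop. 1.1, Lemma 1.2, Prop. 1.3, Thm. 1.4 (pp. 4–6). READ.
  [MunteanuWang2015]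
-/

noncomputable section

set_option maxSynthPendingDepth 3

open Set Filter Module Metric
open scoped Manifold ContDiff Topology NNReal ENNReal

namespace Literature.Geometry.Riemannian

open Lorentzian Lorentzian.PseudoRiemannianMetric

namespace FourShrinker

/-- **The `Rm`-equation input in the registered shape** (`∃ C ∀ charts … ∃ N ≥ 0, Δ_f|Rm|² ≥ 2N −
C(√|Rm|²+1)|Rm|² ∧ |∇|Rm|²|² ≤ 4|Rm|²N`), from `IsMetricOn.lapAt_rmNormSqAt_sub_fderiv_ge_of_soliton`
and `IsMetricOn.gradSqAt_rmNormSqAt_le` in an orthonormal frame, `λ = ½`, `n = 4`, `C = 16·4⁶ + 4·4⁷`.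
[cite: MunteanuWang2015, §1, (id) and proof of Thm. 1.4] -/
theorem rm_drift_input : ∃ C : ℝ, ∀ {E : Type} [NormedAddCommGroup E] [NormedSpace ℝ E]
    [FiniteDimensional ℝ E] [CompleteSpace E] (G : E → E →L[ℝ] E →L[ℝ] ℝ) (V : Set E) (x : E)
    (f : E → ℝ), MetricCoord.IsMetricOn G V → x ∈ V → Module.finrank ℝ E = 4 →
    (∀ y ∈ V, ∀ v : E, v ≠ 0 → 0 < G y v v) → ContDiffOn ℝ ∞ f V →
    (∀ y ∈ V, ∀ v w : E, MetricCoord.ricAt G y v w + MetricCoord.hessAt G f y v w = (1 / 2 : ℝ) * G y v w) →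
    ∃ N : ℝ, 0 ≤ N ∧ 2 * N - C * (Real.sqrt (MetricCoord.rmNormSqAt G x) + 1) * MetricCoord.rmNormSqAt G x ≤
      MetricCoord.lapAt G (MetricCoord.rmNormSqAt G) x
        - fderiv ℝ (MetricCoord.rmNormSqAt G) x (MetricCoord.sharpAt G x (fderiv ℝ f x)) ∧
      MetricCoord.gradSqAt G (MetricCoord.rmNormSqAt G) x ≤ 4 * MetricCoord.rmNormSqAt G x * N := by
  refine ⟨16 * 4 ^ 6 + 4 * 4 ^ 7, ?_⟩
  intro E _ _ _ _ G V x f hG hx h4 hpos hf hsol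
  classical
  obtain ⟨e, he⟩ := MetricCoord.exists_orthonormal_basis (hG.symm x hx) (hpos x hx)
  refine ⟨∑ k, ∑ a, ∑ c, ∑ i, ∑ j,
    (G x (MetricCoord.covRiemAt G x (e k) (e a) (e c) (e i)) (e j)) ^ 2,
    by positivity, ?_, hG.gradSqAt_rmNormSqAt_le e he hx⟩
  have h := hG.lapAt_rmNormSqAt_sub_fderiv_ge_of_soliton e he hx hf hsol
  have hn : (Fintype.card (Fin (finrank ℝ E)) : ℝ) = 4 := by simp [h4]
  rw [hn] at h
  have hu0 : 0 ≤ MetricCoord.rmNormSqAt G x := hG.rmNormSqAt_nonneg e he hx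
  have hK0 : 0 ≤ Real.sqrt (MetricCoord.rmNormSqAt G x) := Real.sqrt_nonneg _
  nlinarith [h, hu0, hK0, mul_nonneg hu0 hK0]

variable {M : Type} [TopologicalSpace M] [T2Space M] [SecondCountableTopology M]
  [ChartedSpace (EuclideanSpace ℝ (Fin 4)) M] [IsManifold (𝓡 4) ∞ M] [ConnectedSpace M]
  [T3Space M] [MeasurableSpace M] [BorelSpace M]
  (g : PseudoRiemannianMetric (𝓡 4) ∞ (EuclideanSpace ℝ (Fin 4)) (TangentSpace (𝓡 4) : M → Type _))
  [g.HasLeviCivita] (f : M → ℝ)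

/-- **Munteanu–Wang 2015, Prop. 1.3 — the Ricci curvature of a complete four-dimensional gradient
shrinking Ricci soliton with bounded scalar curvature is bounded**: for `(M, g, f)` connected,
complete (closed `g`-balls compact), `Ric + Hess f = ½ g`, `R + |∇f|² = f`, `R ≤ A`, there is `C`
with `|Ric|²_g ≤ C` on `M`. Unconditional: `normSq_ricci_bounded_of` with the localised maximum
principle `Shrinker.bounded_of_drift_laplacian_ge_sq`. [cite: MunteanuWang2015, Prop. 1.3] -/
theorem normSq_ricci_bounded (hg : g.IsRiemannian)
    (hc : ∀ (x : M) (r : ℝ≥0), IsCompact {y : M | g.edist hg x y ≤ r})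
    (hf : ContMDiff (𝓡 4) 𝓘(ℝ, ℝ) ∞ f)
    (hsol : ∀ (x : M) (X Y : TangentSpace (𝓡 4) x),
      g.ricci x X Y + g.hessian f x X Y = (1 / 2 : ℝ) * g.val x X Y)
    (hnorm : ∀ x : M, g.scalarCurvature x + g.gradSq f x = f x)
    {A : ℝ} (hA : ∀ x : M, g.scalarCurvature x ≤ A) :
    ∃ C : ℝ, ∀ x : M, g.normSq x (g.ricci x) ≤ C :=
  normSq_ricci_bounded_of g f hg
    (fun _ _ _ _ _ _ _ _ _ g' _ _ _ hg' _ _ _ hα hK hf' hu' hsol' hnorm' hR0' hdrift' ↦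
      Shrinker.bounded_of_drift_laplacian_ge_sq g' hg' hα hK hf' hu' hsol' hnorm' hR0' hdrift')
    hc hf hsol hnorm hA

/-- **Munteanu–Wang 2015, Thm. 1.4 (first half) — the curvature tensor of a complete four-dimensional
gradient shrinking Ricci soliton with bounded scalar curvature is bounded**: for `(M, g, f)` connected,
complete (closed `g`-balls compact), `Ric + Hess f = ½ g`, `R + |∇f|² = f`, `R ≤ A`, there is `C` with
`|Rm|²_g = g.curvNormSqWith g.leviCivita ≤ C` on `M`. Unconditional: `curvNormSq_bounded_of` with
`rm_drift_input` (MW (id) + Kato, `CoordShrinkerRmNormSqDrift.lean`), the localised maximum principle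
`Shrinker.bounded_of_drift_laplacian_ge_sq` and the pointwise drift inequality
`IsMetricOn.mw_drift_sqrt_rmNormSqAt_add_normSqAt_ricAt` (`CoordShrinkerRmDrift.lean`).
[cite: MunteanuWang2015, Thm. 1.4] -/
theorem curvNormSq_bounded (hg : g.IsRiemannian)
    (hc : ∀ (x : M) (r : ℝ≥0), IsCompact {y : M | g.edist hg x y ≤ r})
    (hf : ContMDiff (𝓡 4) 𝓘(ℝ, ℝ) ∞ f)
    (hsol : ∀ (x : M) (X Y : TangentSpace (𝓡 4) x),
      g.ricci x X Y + g.hessian f x X Y = (1 / 2 : ℝ) * g.val x X Y)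
    (hnorm : ∀ x : M, g.scalarCurvature x + g.gradSq f x = f x)
    {A : ℝ} (hA : ∀ x : M, g.scalarCurvature x ≤ A) :
    ∃ C : ℝ, ∀ x : M, g.curvNormSqWith g.leviCivita x ≤ C :=
  curvNormSq_bounded_of g f hg rm_drift_input
    (fun _ _ _ _ _ _ _ _ _ g' _ _ _ hg' _ _ _ hα hK hf' hu' hsol' hnorm' hR0' hdrift' ↦
      Shrinker.bounded_of_drift_laplacian_ge_sq g' hg' hα hK hf' hu' hsol' hnorm' hR0' hdrift')
    (fun _ _ _ f b _ _ hG hx hpos _ _ hC hB hRB hq hP hL hN ↦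
      hG.mw_drift_sqrt_rmNormSqAt_add_normSqAt_ricAt hx hpos f b hC hB hRB hq hP hL hN)
    hc hf hsol hnorm hA

end FourShrinker

end Literature.Geometry.Riemannian

end
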